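import Literature.AnabelianGeometry.SemiGraphs.TemperedLocalTransportSameImageOfSaturated
import Literature.AnabelianGeometry.SemiGraphs.TreeSystemLevelImageTransport
import HarnessLib

/-!
# [SemiAnbd] Thm 3.7 (iii) / Cor 3.9 (R3c): cross-level transport of a fixed branch along a fixed path
# with equal end images, ARBITRARY edge groups, under saturation along the path (proof-only)

Mochizuki, *Semi-graphs of anabelioids*, Publ. RIMS **42** (2006), §3 Theorem 3.7 (iii), proof p. 41
(third paragraph) with the author's *Comments* (2020) (6)(b); Cor. 3.9 p. 43 l. 13 — the cell's step
(R3c), FACT-LIST rows F-2772 `EdgeLikeCentralizerAt` / F-2773 `EdgeLikeCentralizer`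
[cite: MochizukiSemiAnbd2006, Thm 3.7(iii) p.41].

PROOF-ONLY (cell abc-iut, block F, seat abc-iut-f-176 gen 5; the CLASS-FREE form of abc-iut-f-172 gen 7's
brick (B⁺) `GaloisLevelData.exists_fixed_branch_of_sameImage_path` (p491520); no definition, no named
fact).  Setting: a Galois tower `D` of a countable `𝒢`, levels `j ≤ n`, a path `p` of the subdivision of
`𝔾̃_n` from a vertex `a` over `w` to a vertex `z` WITH THE SAME IMAGE AS `a` IN `𝔾̃_j`, every node of
which is fixed by the subgroup `C` of `π₁^temp(𝒢)`, and a branch `δ` at `z` with `C`-fixed edge.  The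
class hypothesis «all edge groups topologically cyclic» of (B⁺) is replaced by SATURATION ALONG THE PATH:
for every branch-point `β` on `p`, every element of `Gal(𝒢_{∞,n}/𝒢)` fixing the edge of `β` and trivial
in `Gal(𝒢_{∞,j}/𝒢)` lies in `ρ_n(C)`.  Conclusion as in (B⁺): `C` fixes the edge of a branch AT `a`
whose image in `𝔾̃_j` is that of `δ`.  The proof is (B⁺)'s strong induction on the length verbatim
(first return of `p` to a vertex with the image of `a`, through a branch with the same `𝔾̃_j`-image as
the first step — the tree `𝔾̃_j` separates), with the one-level transport supplied by the saturated
brick `exists_fixed_branch_transport_sameImage_of_saturated` at the return branch (a branch-point of `p`).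

Honest framing: one sufficient condition; the ∀-closures F-2773 / F-1732 are NOT claimed; nothing here
bears on [IUTchIII] Cor. 3.12; typed ≠ proved elsewhere.
-/

namespace Literature.AnabelianGeometry.SemiGraphs

namespace ProfiniteSemiGraph

namespace GaloisLevelData

open CategoryTheory Topology

universe u

variable {𝒢 : ProfiniteSemiGraph.{u}} (D : GaloisLevelData 𝒢) (h𝒢 : 𝒢.IsCountable)

/-- **CROSS-LEVEL PATH TRANSPORT under saturation** (see the file header): along a `C`-fixed path of
`𝔾̃_n` from `a` to `z`, two vertices with the same image in `𝔾̃_j` (`j ≤ n`), every branch-point of which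
is SATURATED for `C` relative to level `j`, a `C`-fixed branch at `z` is transported to a `C`-fixed branch
at `a` with the same image in `𝔾̃_j` — arbitrary edge groups, NO hypothesis on `𝔾`.
[cite: MochizukiSemiAnbd2006, Thm 3.7(iii) p.41] -/
theorem exists_fixed_branch_of_sameImage_path_of_saturated {j n : ℕ} (hjn : j ≤ n)
    (C : Subgroup (D.temperedPi h𝒢))
    {w : 𝒢.graph.Vertex} (P₀ : D.PointSeq h𝒢 w) {a z : (D.tree n).Vertex}
    (haw : (D.treeProj n).vertexMap a = w)
    (haz : (D.treeTrans hjn).vertexMap a = (D.treeTrans hjn).vertexMap z)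
    (p : (D.tree n).subdivision.Walk (Sum.inl a) (Sum.inl z)) (hp : p.IsPath)
    (hfix : ∀ x ∈ p.support, ∀ g ∈ C, SemiGraph.nodeMap (D.treeAct h𝒢 n g) x = x)
    (hsat : ∀ β : (D.tree n).Branch, (Sum.inr (Sum.inr β) : (D.tree n).Node) ∈ p.support →
      ∀ q : D.Gal h𝒢 n, D.mapLE h𝒢 hjn q = 1 →
        (D.galTreeAct h𝒢 n q).hom.edgeMap ((D.tree n).edgeOf β) = (D.tree n).edgeOf β →
          q ∈ C.map (D.proj h𝒢 n))
    (δ : (D.tree n).Branch) (hδ : (D.tree n).abuts δ = some z)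
    (hδfix : ∀ g ∈ C, (D.treeAct h𝒢 n g).hom.edgeMap ((D.tree n).edgeOf δ) = (D.tree n).edgeOf δ) :
    ∃ α : (D.tree n).Branch, (D.tree n).abuts α = some a ∧
      (D.treeTrans hjn).branchMap α = (D.treeTrans hjn).branchMap δ ∧
      ∀ g ∈ C, (D.treeAct h𝒢 n g).hom.edgeMap ((D.tree n).edgeOf α) = (D.tree n).edgeOf α := by
  classical
  obtain ⟨N, hN⟩ : ∃ N, p.length = N := ⟨_, rfl⟩
  induction N using Nat.strong_induction_on generalizing a p with
  | _ N ih =>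
  rcases Nat.eq_zero_or_pos N with hN0 | hNpos
  · -- the trivial path: `a = z`
    subst hN0
    have haz' : (Sum.inl a : (D.tree n).Node) = Sum.inl z := SimpleGraph.Walk.eq_of_length_eq_zero hN
    have haz'' : a = z := Sum.inl_injective haz'
    subst haz''
    exact ⟨δ, hδ, rfl, hδfix⟩
  -- a fixed branch-point gives a fixed edge
  have hfixE : ∀ β : (D.tree n).Branch, (Sum.inr (Sum.inr β) : (D.tree n).Node) ∈ p.support →
      ∀ g ∈ C, (D.treeAct h𝒢 n g).hom.edgeMap ((D.tree n).edgeOf β) = (D.tree n).edgeOf β := by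
    intro β hβ g hg
    have h := hfix _ hβ g hg
    simp only [SemiGraph.nodeMap_inr_inr, Sum.inr.injEq] at h
    rw [← (D.treeAct h𝒢 n g).hom.edgeOf_branchMap β, h]
  have hlen : 0 < p.length := hN ▸ hNpos
  -- the image vertex `ā` at level `j`
  set abar : (D.tree j).Vertex := (D.treeTrans hjn).vertexMap a with habar
  -- the first step of `p`: a branch `β₁` at `a`
  have hadj₁ := p.adj_getVert_succ (i := 0) hlen
  rw [SimpleGraph.Walk.getVert_zero] at hadj₁
  obtain ⟨β₁, hβ₁a, hβ₁⟩ := ((D.tree n).subdivision_adj_inl_iff a _).mp hadj₁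
  -- the first return to a vertex with image `ā`
  have hex : ∃ i, 0 < i ∧ i ≤ p.length ∧ ∃ u : (D.tree n).Vertex, p.getVert i = Sum.inl u ∧
      (D.treeTrans hjn).vertexMap u = abar :=
    ⟨p.length, hlen, le_rfl, z, p.getVert_length, haz.symm⟩
  set i₀ := Nat.find hex with hi₀
  obtain ⟨hi₀pos, hi₀le, u₀, hu₀, hu₀w⟩ := Nat.find_spec hex
  rw [← hi₀] at hi₀pos hi₀le hu₀
  simp only [Nat.zero_add] at hadj₁ hβ₁
  have hmin : ∀ i, 0 < i → i < i₀ → ∀ u : (D.tree n).Vertex, p.getVert i = Sum.inl u →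
      (D.treeTrans hjn).vertexMap u ≠ abar := by
    intro i hi hii u hiu huw
    exact Nat.find_min hex hii ⟨hi, (le_of_lt hii).trans hi₀le, u, hiu, huw⟩
  have hi₀two : 2 ≤ i₀ := by
    rcases Nat.lt_or_ge i₀ 2 with h | h
    · exfalso
      have h1 : i₀ = 1 := by omega
      rw [h1, hβ₁] at hu₀
      simp at hu₀
    · exact h
  -- the arriving branch `β_r` at `u₀`
  have hadjr := p.adj_getVert_succ (i := i₀ - 1) (by omega)
  rw [show i₀ - 1 + 1 = i₀ by omega, hu₀] at hadjr
  obtain ⟨βr, hβru₀, hβr⟩ := ((D.tree n).subdivision_adj_inl_iff u₀ _).mp hadjr.symm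
  -- base vertex of `u₀`
  have hu₀base : (D.treeProj n).vertexMap u₀ = w := by
    rw [D.treeProj_vertexMap_eq_treeProj_treeTrans hjn, hu₀w, habar,
      ← D.treeProj_vertexMap_eq_treeProj_treeTrans hjn, haw]
  -- image branches at level `j`
  have hb₁w : (D.tree j).abuts ((D.treeTrans hjn).branchMap β₁) = some abar := by
    rw [(D.treeTrans hjn).abuts_branchMap β₁ a hβ₁a]
  have hbrw : (D.tree j).abuts ((D.treeTrans hjn).branchMap βr) = some abar := by
    rw [(D.treeTrans hjn).abuts_branchMap βr u₀ hβru₀, hu₀w]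
  -- KEY: the first return is through the image branch of the first step (the tree `𝔾̃_j`)
  have hkey : (D.treeTrans hjn).branchMap βr = (D.treeTrans hjn).branchMap β₁ := by
    let Φ : (D.tree n).subdivision →g (D.tree j).subdivision :=
      ⟨Sum.map (D.treeTrans hjn).vertexMap (Sum.map (D.treeTrans hjn).edgeMap (D.treeTrans hjn).branchMap),
        fun h => SemiGraph.subdivision_adj_map (D.treeTrans hjn) h⟩
    let W := p.map Φ
    have hWv : ∀ i, W.getVert i = Φ (p.getVert i) := fun i => SimpleGraph.Walk.getVert_map Φ p i
    let W₁ := (W.drop 1).take (i₀ - 2)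
    have hstart : W.getVert 1 = Sum.inr (Sum.inr ((D.treeTrans hjn).branchMap β₁)) := by
      rw [hWv, hβ₁]; rfl
    have hend : (W.drop 1).getVert (i₀ - 2) = Sum.inr (Sum.inr ((D.treeTrans hjn).branchMap βr)) := by
      rw [SimpleGraph.Walk.drop_getVert, show 1 + (i₀ - 2) = i₀ - 1 by omega, hWv, hβr]; rfl
    let W₁' : (D.tree j).subdivision.Walk (Sum.inr (Sum.inr ((D.treeTrans hjn).branchMap β₁)))
        (Sum.inr (Sum.inr ((D.treeTrans hjn).branchMap βr))) := W₁.copy hstart hend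
    have havoid : (Sum.inl abar : (D.tree j).Node) ∉ W₁'.support := by
      intro hw
      rw [SimpleGraph.Walk.support_copy] at hw
      obtain ⟨m, hm, hmle⟩ := SimpleGraph.Walk.mem_support_iff_exists_getVert.mp hw
      rw [SimpleGraph.Walk.take_getVert, SimpleGraph.Walk.drop_getVert, hWv] at hm
      have hmle' : m ≤ i₀ - 2 := by
        have := hmle
        rw [SimpleGraph.Walk.take_length] at this
        exact le_trans this (min_le_left _ _)
      rw [min_eq_right hmle'] at hm
      -- the node `p.getVert (1 + m)` maps to the point of `ā`: it is a vertex with image `ā`, too early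
      have hm' : Sum.map (D.treeTrans hjn).vertexMap
          (Sum.map (D.treeTrans hjn).edgeMap (D.treeTrans hjn).branchMap) (p.getVert (1 + m)) =
            Sum.inl abar := hm
      rcases hxc : p.getVert (1 + m) with u | e | c
      · rw [hxc] at hm'
        have hu : (D.treeTrans hjn).vertexMap u = abar := Sum.inl_injective hm'
        exact hmin (1 + m) (by omega) (by omega) u hxc hu
      · rw [hxc] at hm'; simp at hm'
      · rw [hxc] at hm'; simp at hm'
    exact (SemiGraph.branch_eq_of_walk_avoiding_vertex (D.isTree_tree j).isTree.isAcyclic hb₁w hbrw W₁'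
      havoid).symm
  -- base branches
  have hb₁base : 𝒢.graph.abuts ((D.treeProj n).branchMap β₁) = some w := by
    rw [(D.treeProj n).abuts_branchMap β₁ a hβ₁a, haw]
  have hβrb : (D.treeProj n).branchMap βr = (D.treeProj n).branchMap β₁ := by
    rw [D.treeProj_branchMap_eq_treeProj_treeTrans hjn, hkey, ← D.treeProj_branchMap_eq_treeProj_treeTrans hjn]
  -- the tail path from `u₀` to `z`: shorter, still `C`-fixed, same image ends
  let q : (D.tree n).subdivision.Walk (Sum.inl u₀) (Sum.inl z) := (p.drop i₀).copy hu₀ rfl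
  have hqlen : q.length < N := by
    rw [SimpleGraph.Walk.length_copy, SimpleGraph.Walk.drop_length]
    omega
  have hqsupp : ∀ x ∈ q.support, x ∈ p.support := by
    intro x hx
    rw [SimpleGraph.Walk.support_copy, SimpleGraph.Walk.drop_support_eq_support_drop_min] at hx
    exact List.drop_subset _ _ hx
  have hqpath : q.IsPath := by
    refine SimpleGraph.Walk.IsPath.mk' ?_
    rw [SimpleGraph.Walk.support_copy, SimpleGraph.Walk.drop_support_eq_support_drop_min]
    exact hp.support_nodup.sublist (List.drop_sublist _ _)
  have hu₀z : (D.treeTrans hjn).vertexMap u₀ = (D.treeTrans hjn).vertexMap z := by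
    rw [hu₀w]; exact haz
  obtain ⟨β'', hβ''u₀, hβ''img, hβ''fix⟩ :=
    ih q.length hqlen hu₀base hu₀z q hqpath (fun x hx => hfix x (hqsupp x hx))
      (fun β hβ => hsat β (hqsupp _ hβ)) rfl
  -- the image-preserving local transport at `w` from `u₀` back to `a`
  have hδbase : 𝒢.graph.abuts ((D.treeProj n).branchMap β'') = some w := by
    rw [(D.treeProj n).abuts_branchMap β'' u₀ hβ''u₀, hu₀base]
  have hβ₁mem : (Sum.inr (Sum.inr β₁) : (D.tree n).Node) ∈ p.support := by
    rw [← hβ₁]; exact p.getVert_mem_support 1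
  have hβrmem : (Sum.inr (Sum.inr βr) : (D.tree n).Node) ∈ p.support := by
    rw [← hβr]; exact p.getVert_mem_support (i₀ - 1)
  obtain ⟨α, hαa, -, hαimg, hαfix⟩ := D.exists_fixed_branch_transport_sameImage_of_saturated h𝒢 hjn C P₀
    hb₁base hδbase haw hu₀base β₁ βr β'' hβ₁a rfl hβru₀ hβrb hβ''u₀ rfl hkey.symm (hsat βr hβrmem)
    (hfixE β₁ hβ₁mem) (hfixE βr hβrmem) hβ''fix
  exact ⟨α, hαa, hαimg.trans hβ''img, hαfix⟩

end GaloisLevelData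

end ProfiniteSemiGraph

end Literature.AnabelianGeometry.SemiGraphs
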